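import Mathlib
import HarnessLib
import Summits.FinalStateConjecture.Statement
import Literature.Geometry.Lorentzian.BurnettConvergence

/-!
# Sketch — first lemmas for the crux-ideate cards on `ClusterCompleteness.OmegaLimitMultiKerr`
(planner-cruxidea-stmt-FinalStateConjecture-14664-2-0, round 1, ideator 2)

The crux (`OmegaLimitMultiKerr`, stmt-FinalStateConjecture-14664) is FIXED; nothing here restates
or weakens it. Contents:

* §0 `Settles`, `Recurs k`, `OmegaAt k` — the crux's two disjuncts and its instance at order `k`.
  (The certificate `omegaLimitMultiKerr_iff : OmegaLimitMultiKerr ↔ ∀ k, OmegaAt k := Iff.rfl`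
  is in the evidence copy `Sketch.lean` attached to stmt-FinalStateConjecture-14664, which imports
  the route file; this published copy imports only the Statement so that it elaborates on a farm
  whose snapshot of `Theses/ClusterCompleteness.lean` lags the tree.)
* §A (card `free-energy-episode-packing`): `packing` — an antitone, bounded-below ledger that
  drops by `δ` across `[τ - L, τ + L]` at every bad time `τ` has a bounded-above bad set (the
  closing move that turns a toll into the all-late-times anchor F2); `far_of_tendstoUniformlyOn` —
  `C⁰`-farness from a reference passes to (locally) uniform, in particular Burnett, limits (the
  first step of the toll's compactness proof).
* §B (card `wandering-labels-recentring`): `recentre` and `recurs_fixed_label_of_isSeqCompact` —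
  closeness to models with WANDERING labels `p n` at times `τ n → ∞`, labels in a sequentially
  compact box, gives `∃ᶠ`-closeness to ONE fixed label (the crux's shape `∀ ε > 0, ∃ᶠ τ in atTop,
  dev ≤ ε`), granted only a triangle inequality and continuity of the model family in the label;
  §B′ `continuousOn_kerr_bilin_param` (joint continuity of `(M, a, x) ↦ g_{M,a}(x)` on `{r > 0}`)
  and `kerr_bilin_uniform_on_compact` (uniform in `x` on compact slabs: the `k = 0` instance of
  that continuity hypothesis for the Kerr–Schild family), both sorry-free.
* §C (card `quarantine-the-far-field`): `interp_reduces_order` — `C²`-smallness plus a-priori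
  `Cᵐ`-BOUNDEDNESS gives `Cᵏ`-smallness for `2 ≤ k < m` whenever a multiplicative
  (Landau–Kolmogorov / Gagliardo–Nirenberg-type) interpolation inequality holds for the norms in
  play: the formal shape of "`Recurs 2` + bounded higher geometry i.o. ⇒ `Recurs k`".
-/

open scoped Manifold ContDiff Topology ENNReal NNReal
open Set Filter TopologicalSpace Literature.Geometry.Lorentzian

noncomputable section

namespace Summit.FinalStateConjecture.FinalStateConjecture.Cruxes.OmegaLimitMultiKerr.SketchIdeator2

/-! ### §0 The crux per order `k` and its two disjuncts -/

section Crux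

variable {X : Type} [TopologicalSpace X] [ChartedSpace E3 X] [IsManifold (𝓡 3) ∞ X]
  [T2Space X] [SecondCountableTopology X] [ConnectedSpace X] {D : InitialDataSet (𝓡 3) X}

/-- The SETTLE disjunct of the crux for one maximal development: complete `𝓘⁺` and a `C²`
sub-extremal multi-Kerr decomposition with exhaustive charts of its self-determined exterior
(verbatim the negated conjunct of `OmegaLimitMultiKerr`). -/
def Settles (𝒟 : VacuumCauchyDevelopment D) : Prop :=
  Summit.FinalStateConjecture.HasCompleteNullInfinity 𝒟.toCauchyDevelopment ∧
    ∃ (O : Set 𝒟.carrier) (d : FinalStateDecomposition 𝒟.toSpacetime O 2),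
      (∀ i, Kerr.IsSubextremal (d.mass i) (d.spin i)) ∧
        O = Summit.FinalStateConjecture.exteriorOf 𝒟.toCauchyDevelopment d.charted ∧
          Summit.FinalStateConjecture.HasExhaustiveCharts d

/-- The RECUR disjunct of the crux at order `k` for one maximal development (verbatim the
conclusion of `OmegaLimitMultiKerr`, = the hypothesis of `RecurrentMultiKerrCapture`). -/
def Recurs (k : ℕ) (𝒟 : VacuumCauchyDevelopment D) : Prop :=
  ∃ (O : Set 𝒟.carrier) (N : ℕ) (M a : Fin N → ℝ) (mo : Fin N → lorentzGroup × E4) (τ₀ : ℝ)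
    (Ψ : ∀ i, boostedKerrExterior (mo i).1 (mo i).2 (M i) (a i) → 𝒟.carrier)
    (ρ R : Fin N → ℝ → ℝ) (U₀ : Opens E4) (Ψ₀ : U₀ → 𝒟.carrier),
    (∀ i, Kerr.IsSubextremal (M i) (a i)) ∧
    (∀ i, 𝒟.toSpacetime.IsLateChart (boostedKerrBackground (mo i).1 (mo i).2 (M i) (a i)) O τ₀
      (Ψ i)) ∧
    𝒟.toSpacetime.IsLateChart (Minkowski.backgroundOn U₀) O τ₀ Ψ₀ ∧
    (∀ i, Tendsto (fun t ↦ ρ i t / t) atTop (𝓝 0)) ∧ (∀ i, Tendsto (R i) atTop atTop) ∧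
    {x : E4 | τ₀ < x 0 ∧ ∀ i, ρ i (x 0) <
      Kerr.radius (a i) (poincareInv (mo i).1 (mo i).2 x)} ⊆ (U₀ : Set E4) ∧
    (∀ R' : ℝ, ∃ τ₁ : ℝ, Pairwise (Function.onFun Disjoint fun i ↦ Ψ i ''
      (boostedKerrBackground (mo i).1 (mo i).2 (M i) (a i)).truncLateRegion τ₁ R')) ∧
    O = Summit.FinalStateConjecture.exteriorOf 𝒟.toCauchyDevelopment
      ((⋃ i, Ψ i '' (boostedKerrBackground (mo i).1 (mo i).2 (M i) (a i)).lateRegion τ₀) ∪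
        Ψ₀ '' (Minkowski.backgroundOn U₀).lateRegion τ₀) ∧
    (∀ τ₁ : ℝ, τ₀ < τ₁ → O \ (Ψ₀ '' (Minkowski.backgroundOn U₀).lateRegion τ₁ ∪
      ⋃ i, Ψ i '' {x | τ₁ < (boostedKerrBackground (mo i).1 (mo i).2 (M i) (a i)).time x.1 ∧
        (boostedKerrBackground (mo i).1 (mo i).2 (M i) (a i)).radius x.1 ≤
          R i ((boostedKerrBackground (mo i).1 (mo i).2 (M i) (a i)).time x.1)}) ⊆
      𝒟.metric.causalPast 𝒟.timeOrientation (Ψ₀ '' (Minkowski.backgroundOn U₀).timeSlab τ₁ ∪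
        ⋃ i, Ψ i '' (boostedKerrBackground (mo i).1 (mo i).2 (M i) (a i)).truncTimeSlab
          (R i τ₁) τ₁)) ∧
    (∀ τ : ℝ, τ₀ < τ →
      𝒟.toSpacetime.deviationCk (Minkowski.backgroundOn U₀) Ψ₀ 0 τ ≤ ENNReal.ofReal (1 / 4) ∧
      ∀ i, 𝒟.toSpacetime.truncDeviationCk (boostedKerrBackground (mo i).1 (mo i).2 (M i) (a i))
        (Ψ i) 0 (R i τ) τ ≤ ENNReal.ofReal (1 / 4)) ∧
    ∀ R' : ℝ, ∀ ε : ℝ, 0 < ε → ∃ᶠ τ in atTop,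
      𝒟.toSpacetime.deviationCk (Minkowski.backgroundOn U₀) Ψ₀ k τ ≤ ENNReal.ofReal ε ∧
      ∀ i, 𝒟.toSpacetime.truncDeviationCk (boostedKerrBackground (mo i).1 (mo i).2 (M i) (a i))
        (Ψ i) k R' τ ≤ ENNReal.ofReal ε

end Crux

/-- The crux at ONE order `k`: Christodoulou-generically in the admissible class, an MGHD exists
and every MGHD that does not settle recurs at order `k`. -/
def OmegaAt (k : ℕ) : Prop :=
  ∀ (X : Type) [TopologicalSpace X] [ChartedSpace E3 X] [IsManifold (𝓡 3) ∞ X] [T2Space X]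
    [SecondCountableTopology X] [ConnectedSpace X],
    InitialDataSet.IsChristodoulouGeneric (admissibleVacuumData X)
      (fun D ↦ (∃ 𝒟 : VacuumCauchyDevelopment D, 𝒟.IsMaximal) ∧
        ∀ 𝒟 : VacuumCauchyDevelopment D, 𝒟.IsMaximal → ¬ Settles 𝒟 → Recurs k 𝒟) 1

-- `theorem omegaLimitMultiKerr_iff : OmegaLimitMultiKerr ↔ ∀ k, OmegaAt k := Iff.rfl`
-- (kernel-checked in the evidence copy, which imports `Theses.ClusterCompleteness`).

/-! ### §A Packing: a toll against an antitone bounded ledger bounds the bad set -/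

/-- **Packing lemma.** Let `F` be an antitone ledger bounded below by `m` (the free energy
`M_B(u(τ)) - √(A(v(τ))/16π)` read in chart time). If every bad time `τ` costs a drop
`F (τ - L) - F (τ + L) ≥ δ > 0`, then the bad set is bounded above: after some chart time every
time is good. This is the move that turns a COARSE TOLL into the all-late-times anchor F2. -/
theorem packing {F : ℝ → ℝ} (hF : Antitone F) {m : ℝ} (hm : ∀ t, m ≤ F t) {δ L : ℝ}
    (hδ : 0 < δ) {bad : Set ℝ}
    (htoll : ∀ τ ∈ bad, δ ≤ F (τ - L) - F (τ + L)) : BddAbove bad := by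
  by_contra hbad
  rw [not_bddAbove_iff] at hbad
  -- a chain of bad times with gaps `≥ 2L`
  have step : ∀ s : ℝ, ∃ τ ∈ bad, s ≤ τ := fun s ↦ by
    obtain ⟨τ, hτ, hsτ⟩ := hbad s
    exact ⟨τ, hτ, hsτ.le⟩
  choose g hg_mem hg_ge using step
  obtain ⟨τ₀, hτ₀⟩ : bad.Nonempty := by
    obtain ⟨τ, hτ, -⟩ := hbad 0
    exact ⟨τ, hτ⟩
  let c : ℕ → ℝ := fun n ↦ Nat.rec τ₀ (fun _ t ↦ g (t + 2 * L)) n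
  have hc_zero : c 0 = τ₀ := rfl
  have hc_succ : ∀ n, c (n + 1) = g (c n + 2 * L) := fun n ↦ rfl
  have hc_mem : ∀ n, c n ∈ bad := by
    intro n
    cases n with
    | zero => exact hτ₀
    | succ n => rw [hc_succ]; exact hg_mem _
  have hc_gap : ∀ n, c n + 2 * L ≤ c (n + 1) := fun n ↦ by rw [hc_succ]; exact hg_ge _
  -- telescoping: `(n + 1) δ ≤ F (c 0 - L) - F (c n + L)`
  have chain : ∀ n : ℕ, (n + 1) * δ ≤ F (c 0 - L) - F (c n + L) := by
    intro n
    induction n with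
    | zero => simpa using htoll _ (hc_mem 0)
    | succ n ih =>
      have h1 := htoll _ (hc_mem (n + 1))
      have h2 : F (c (n + 1) - L) ≤ F (c n + L) := hF (by linarith [hc_gap n])
      push_cast at ih ⊢
      linarith
  obtain ⟨n, hn⟩ := exists_nat_gt ((F (c 0 - L) - m) / δ)
  have hlow := hm (c n + L)
  have key := chain n
  have : (F (c 0 - L) - m) / δ * δ = F (c 0 - L) - m := div_mul_cancel₀ _ hδ.ne'
  nlinarith

/-- **`C⁰`-farness passes to uniform limits.** If `g n → g₀` uniformly on `S` and every `g n` is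
`η`-far in sup norm on `S` from the reference `ref` (at some point of `S`), then `g₀` is `η'`-far
from `ref` for every `η' < η`. With `BurnettConverges` (locally uniform convergence) and compact
`S` this is the first step of the coarse toll's compactness-and-contradiction proof: an
order-one `C⁰` non-Kerrness survives the passage to the (Einstein–null-dust) Burnett limit. -/
theorem far_of_tendstoUniformlyOn {Y F : Type*} [NormedAddCommGroup F] {g : ℕ → Y → F}
    {g₀ ref : Y → F} {S : Set Y} (h : TendstoUniformlyOn g g₀ atTop S) {η : ℝ}
    (hfar : ∀ n, ∃ x ∈ S, η ≤ ‖g n x - ref x‖) {η' : ℝ} (hη' : η' < η) :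
    ∃ x ∈ S, η' ≤ ‖g₀ x - ref x‖ := by
  rw [Metric.tendstoUniformlyOn_iff] at h
  obtain ⟨n, hn⟩ := (h (η - η') (by linarith)).exists_forall_of_atTop
  obtain ⟨x, hxS, hx⟩ := hfar n
  refine ⟨x, hxS, ?_⟩
  have hdist : dist (g₀ x) (g n x) < η - η' := hn n le_rfl x hxS
  have htri : ‖g n x - ref x‖ ≤ ‖g n x - g₀ x‖ + ‖g₀ x - ref x‖ := norm_sub_le_norm_sub_add_norm_sub _ _ _
  rw [dist_eq_norm, ← norm_neg, neg_sub] at hdist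
  linarith

/-- The Burnett form: locally uniform convergence on a compact `S` is uniform, so `C⁰`-farness
from `ref` passes to Burnett limits of chart metrics (`BurnettConverges`, Huneau–Luk 2024,
Remark 1.3). -/
theorem far_of_burnettConverges {E F : Type*} [NormedAddCommGroup E] [NormedAddCommGroup F]
    {U S : Set E} {g : ℕ → E → F} {g₀ ref : E → F} (h : BurnettConverges U g g₀) (hSU : S ⊆ U)
    (hS : IsCompact S) {η : ℝ} (hfar : ∀ n, ∃ x ∈ S, η ≤ ‖g n x - ref x‖) {η' : ℝ}
    (hη' : η' < η) : ∃ x ∈ S, η' ≤ ‖g₀ x - ref x‖ :=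
  far_of_tendstoUniformlyOn
    ((tendstoLocallyUniformlyOn_iff_tendstoUniformlyOn_of_compact hS).mp
      (h.tendstoLocallyUniformlyOn.mono hSU)) hfar hη'

/-! ### §B Re-centring: wandering labels, one fixed configuration -/

/-- **Re-centring lemma.** `dev p τ` is the deviation (in whatever `Cᵏ` sup norm, valued in
`ℝ≥0∞` like `Spacetime.truncDeviationCk`) of the solution at chart time `τ` from the model with
label `p` (mass, spin, Lorentz label of one hole); `dist p q` bounds the deviation between the
MODELS `p` and `q` on the slab (triangle inequality `htri`) and is continuous at the diagonal
(`hcont`: the model family is continuous in its label in that norm). If the solution is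
`dev (p n) (τ n) → 0`-close to wandering labels `p n → q` at times `τ n → ∞`, then it is
`∃ᶠ`-close to the ONE fixed label `q` — exactly the shape `∀ ε > 0, ∃ᶠ τ in atTop, dev q τ ≤ ε`
of the crux's recurrence clause. No convergence of the labels along ALL times is used. -/
theorem recentre {P : Type*} [TopologicalSpace P] (dev : P → ℝ → ℝ≥0∞) (dist : P → P → ℝ≥0∞)
    (htri : ∀ p q τ, dev q τ ≤ dev p τ + dist p q) {q : P}
    (hcont : Tendsto (fun p ↦ dist p q) (𝓝 q) (𝓝 0)) {p : ℕ → P} {τ : ℕ → ℝ}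
    (hp : Tendsto p atTop (𝓝 q)) (hτ : Tendsto τ atTop atTop)
    (hdev : Tendsto (fun n ↦ dev (p n) (τ n)) atTop (𝓝 0)) :
    ∀ ε : ℝ≥0∞, 0 < ε → ∃ᶠ σ in atTop, dev q σ ≤ ε := by
  intro ε hε
  have hsum : Tendsto (fun n ↦ dev (p n) (τ n) + dist (p n) q) atTop (𝓝 0) := by
    simpa using hdev.add (hcont.comp hp)
  have hq : Tendsto (fun n ↦ dev q (τ n)) atTop (𝓝 0) :=
    tendsto_of_tendsto_of_tendsto_of_le_of_le tendsto_const_nhds hsum (fun _ ↦ bot_le)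
      fun n ↦ htri (p n) q (τ n)
  have hev : ∀ᶠ n in atTop, dev q (τ n) ≤ ε := hq.eventually (ge_mem_nhds hε)
  exact hτ.frequently (hev.frequently)

/-- **Label-box lemma.** If the labels `p n` stay in a sequentially compact box `K` (masses in
`[m₀, M_ADM]`, spins `|a| ≤ M`, boosts `|v| ≤ 1 - δ`), closeness with wandering labels at times
`τ n → ∞` yields ONE label `q ∈ K` to which the solution is `∃ᶠ`-close for every `ε > 0`: the
configuration the crux asks for is a LIMIT POINT of the label path, nothing more. -/
theorem recurs_fixed_label_of_isSeqCompact {P : Type*} [TopologicalSpace P]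
    (dev : P → ℝ → ℝ≥0∞) (dist : P → P → ℝ≥0∞) (htri : ∀ p q τ, dev q τ ≤ dev p τ + dist p q)
    (hcont : ∀ q, Tendsto (fun p ↦ dist p q) (𝓝 q) (𝓝 0)) {K : Set P} (hK : IsSeqCompact K)
    {p : ℕ → P} (hpK : ∀ n, p n ∈ K) {τ : ℕ → ℝ} (hτ : Tendsto τ atTop atTop)
    (hdev : Tendsto (fun n ↦ dev (p n) (τ n)) atTop (𝓝 0)) :
    ∃ q ∈ K, ∀ ε : ℝ≥0∞, 0 < ε → ∃ᶠ σ in atTop, dev q σ ≤ ε := by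
  obtain ⟨q, hqK, φ, hφ, hlim⟩ := hK hpK
  refine ⟨q, hqK, ?_⟩
  exact recentre dev dist htri (hcont q) hlim (hτ.comp hφ.tendsto_atTop) (hdev.comp hφ.tendsto_atTop)

/-! ### §B′ The `hcont` hypothesis at `k = 0`: the Kerr–Schild family is continuous in its labels, uniformly on compact slabs -/


/-- Joint continuity of the Kerr–Schild radius in `(a, x)`. -/
theorem continuous_radius_param : Continuous (fun q : ℝ × E4 ↦ Kerr.radius q.1 q.2) := by
  unfold Kerr.radius E4.spatialNorm
  fun_prop

/-- Joint continuity of the Kerr–Schild scalar `H` in `(M, a, x)` on `{r > 0}`. -/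
theorem continuousOn_scalarH_param :
    ContinuousOn (fun q : (ℝ × ℝ) × E4 ↦ Kerr.scalarH q.1.1 q.1.2 q.2)
      {q | 0 < Kerr.radius q.1.2 q.2} := by
  have hr : Continuous (fun q : (ℝ × ℝ) × E4 ↦ Kerr.radius q.1.2 q.2) := by
    unfold Kerr.radius E4.spatialNorm
    fun_prop
  have h3 : Continuous (fun q : (ℝ × ℝ) × E4 ↦ q.2 3) := by fun_prop
  have hnum : Continuous (fun q : (ℝ × ℝ) × E4 ↦ q.1.1 * Kerr.radius q.1.2 q.2 ^ 3) :=
    continuous_fst.fst.mul (hr.pow 3)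
  have hden : Continuous (fun q : (ℝ × ℝ) × E4 ↦ Kerr.radius q.1.2 q.2 ^ 4 + q.1.2 ^ 2 * q.2 3 ^ 2) :=
    (hr.pow 4).add ((continuous_fst.snd.pow 2).mul (h3.pow 2))
  have hne : ∀ q ∈ {q : (ℝ × ℝ) × E4 | 0 < Kerr.radius q.1.2 q.2},
      Kerr.radius q.1.2 q.2 ^ 4 + q.1.2 ^ 2 * q.2 3 ^ 2 ≠ 0 := by
    intro q hq
    have : 0 < Kerr.radius q.1.2 q.2 := hq
    positivity
  have h := hnum.continuousOn.div hden.continuousOn hne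
  exact h.congr fun q _ ↦ rfl

/-- Joint continuity of the components of the Kerr–Schild null covector in `(a, x)` on `{r > 0}`. -/
theorem continuousOn_nullCovectorFun_param (μ : Fin 4) :
    ContinuousOn (fun q : (ℝ × ℝ) × E4 ↦ Kerr.nullCovectorFun q.1.2 q.2 μ)
      {q | 0 < Kerr.radius q.1.2 q.2} := by
  have hr : Continuous (fun q : (ℝ × ℝ) × E4 ↦ Kerr.radius q.1.2 q.2) := by
    unfold Kerr.radius E4.spatialNorm
    fun_prop
  have ha : Continuous (fun q : (ℝ × ℝ) × E4 ↦ q.1.2) := by fun_prop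
  have h1 : Continuous (fun q : (ℝ × ℝ) × E4 ↦ q.2 1) := by fun_prop
  have h2 : Continuous (fun q : (ℝ × ℝ) × E4 ↦ q.2 2) := by fun_prop
  have h3 : Continuous (fun q : (ℝ × ℝ) × E4 ↦ q.2 3) := by fun_prop
  have hden : ∀ q ∈ {q : (ℝ × ℝ) × E4 | 0 < Kerr.radius q.1.2 q.2},
      Kerr.radius q.1.2 q.2 ^ 2 + q.1.2 ^ 2 ≠ 0 := by
    intro q hq
    have : 0 < Kerr.radius q.1.2 q.2 := hq
    positivity
  fin_cases μ
  · simp only [Kerr.nullCovectorFun, Fin.zero_eta, Matrix.cons_val_zero]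
    exact continuousOn_const
  · simp only [Kerr.nullCovectorFun, Fin.mk_one, Matrix.cons_val_one, Matrix.cons_val_zero]
    exact ((hr.mul h1).add (ha.mul h2)).continuousOn.div
      ((hr.pow 2).add (ha.pow 2)).continuousOn hden
  · simp only [Kerr.nullCovectorFun, Fin.reduceFinMk, Matrix.cons_val]
    exact ((hr.mul h2).sub (ha.mul h1)).continuousOn.div
      ((hr.pow 2).add (ha.pow 2)).continuousOn hden
  · simp only [Kerr.nullCovectorFun, Fin.reduceFinMk, Matrix.cons_val]
    refine h3.continuousOn.div hr.continuousOn ?_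
    intro q hq
    exact (ne_of_gt (show 0 < Kerr.radius q.1.2 q.2 from hq))

/-- Joint continuity of the Kerr–Schild null covector `ℓ(a, x) : E4 →L[ℝ] ℝ` in `(a, x)` on `{r > 0}`. -/
theorem continuousOn_nullCovector_param :
    ContinuousOn (fun q : (ℝ × ℝ) × E4 ↦ Kerr.nullCovector q.1.2 q.2)
      {q | 0 < Kerr.radius q.1.2 q.2} := by
  have : (fun q : (ℝ × ℝ) × E4 ↦ Kerr.nullCovector q.1.2 q.2) =
      fun q ↦ ∑ μ : Fin 4, Kerr.nullCovectorFun q.1.2 q.2 μ • E4.dx μ := by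
    funext q; rfl
  rw [this]
  refine continuousOn_finsetSum _ fun μ _ ↦ ?_
  exact (continuousOn_nullCovectorFun_param μ).smul continuousOn_const

/-- `ContinuousAdd` on the space of bilinear-form-valued maps (instance path made explicit: the
`Add` instance found by typeclass search and the one underlying `IsTopologicalAddGroup` differ
syntactically, which stalls automatic synthesis). -/
theorem clm2_continuousAdd : ContinuousAdd (E4 →L[ℝ] E4 →L[ℝ] ℝ) := by
  have hG : IsTopologicalAddGroup (E4 →L[ℝ] E4 →L[ℝ] ℝ) := inferInstance
  have h := @ContinuousAdd.continuous_add _ _ _ hG.toContinuousAdd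
  exact ⟨h⟩

set_option synthInstance.maxHeartbeats 400000 in
set_option maxHeartbeats 800000 in
/-- **Joint continuity of the Kerr–Schild family in its labels**: `(M, a, x) ↦ g_{M,a}(x)` is
continuous on `{r(a, x) > 0}` as a map into continuous bilinear forms — the `k = 0` case of the
`hcont` hypothesis of the re-centring lemma. -/
theorem continuousOn_kerr_bilin_param :
    ContinuousOn (fun q : (ℝ × ℝ) × E4 ↦ Kerr.bilin q.1.1 q.1.2 q.2)
      {q | 0 < Kerr.radius q.1.2 q.2} := by
  haveI := clm2_continuousAdd
  have hℓ : ContinuousOn (fun q : (ℝ × ℝ) × E4 ↦ Kerr.nullCovector q.1.2 q.2)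
      {q | 0 < Kerr.radius q.1.2 q.2} := continuousOn_nullCovector_param
  have hH : ContinuousOn (fun q : (ℝ × ℝ) × E4 ↦ 2 * Kerr.scalarH q.1.1 q.1.2 q.2)
      {q | 0 < Kerr.radius q.1.2 q.2} := continuousOn_const.mul continuousOn_scalarH_param
  have htmul : Continuous (fun p : (E4 →L[ℝ] ℝ) × (E4 →L[ℝ] ℝ) ↦ E4.tmul p.1 p.2) := by
    have : (fun p : (E4 →L[ℝ] ℝ) × (E4 →L[ℝ] ℝ) ↦ E4.tmul p.1 p.2) =
        fun p : (E4 →L[ℝ] ℝ) × (E4 →L[ℝ] ℝ) ↦ ContinuousLinearMap.smulRightL ℝ E4 (E4 →L[ℝ] ℝ) p.1 p.2 := by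
      funext p; rfl
    rw [this]
    exact (ContinuousLinearMap.smulRightL ℝ E4 (E4 →L[ℝ] ℝ)).continuous₂
  have hT : ContinuousOn (fun q : (ℝ × ℝ) × E4 ↦
      E4.tmul (Kerr.nullCovector q.1.2 q.2) (Kerr.nullCovector q.1.2 q.2))
      {q | 0 < Kerr.radius q.1.2 q.2} := htmul.comp_continuousOn (hℓ.prodMk hℓ)
  have hsum : ContinuousOn (fun q : (ℝ × ℝ) × E4 ↦ Minkowski.bilin +
      (2 * Kerr.scalarH q.1.1 q.1.2 q.2) •
        E4.tmul (Kerr.nullCovector q.1.2 q.2) (Kerr.nullCovector q.1.2 q.2))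
      {q | 0 < Kerr.radius q.1.2 q.2} := continuousOn_const.add (hH.smul hT)
  exact hsum.congr fun q _ ↦ rfl



/-- **Uniform-in-`x` continuity of the Kerr–Schild family in its labels on compact slabs**
(the `k = 0` instance of the `hcont` hypothesis of the re-centring lemma): for a compact set `S`
of the chart on which `r(a₀, ·) > 0`, the forms `g_{M,a}(x)` converge to `g_{M₀,a₀}(x)` uniformly
in `x ∈ S` as `(M, a) → (M₀, a₀)`. -/
theorem kerr_bilin_uniform_on_compact {S : Set E4} (hS : IsCompact S) {M₀ a₀ : ℝ}
    (hpos : ∀ x ∈ S, 0 < Kerr.radius a₀ x) {ε : ℝ} (hε : 0 < ε) :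
    ∀ᶠ p in 𝓝 (M₀, a₀), ∀ x ∈ S, dist (Kerr.bilin p.1 p.2 x) (Kerr.bilin M₀ a₀ x) < ε := by
  rcases S.eq_empty_or_nonempty with rfl | hne
  · exact Eventually.of_forall fun p x hx ↦ hx.elim
  -- the parameter set on which `r > 0` along `S`
  set s : Set (ℝ × ℝ) := {p | ∀ x ∈ S, 0 < Kerr.radius p.2 x} with hs
  have hq : (M₀, a₀) ∈ s := hpos
  -- `s` is a neighbourhood of `(M₀, a₀)`: the infimum of `r` over the compact `S` is continuous in the label
  have hrad : Continuous (fun q : (ℝ × ℝ) × E4 ↦ Kerr.radius q.1.2 q.2) := by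
    unfold Kerr.radius E4.spatialNorm
    fun_prop
  have hinf : Continuous (fun p : ℝ × ℝ ↦ sInf ((fun x ↦ Kerr.radius p.2 x) '' S)) :=
    hS.continuous_sInf (f := fun (p : ℝ × ℝ) (x : E4) ↦ Kerr.radius p.2 x) hrad
  have hs_eq : s = (fun p : ℝ × ℝ ↦ sInf ((fun x ↦ Kerr.radius p.2 x) '' S)) ⁻¹' Ioi 0 := by
    ext p
    simp only [hs, mem_setOf_eq, mem_preimage, mem_Ioi]
    constructor
    · intro h
      obtain ⟨x, hxS, hxmin⟩ := hS.exists_isMinOn hne (hrad.comp (Continuous.prodMk_right p)).continuousOn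
      have hmem : Kerr.radius p.2 x ∈ (fun x ↦ Kerr.radius p.2 x) '' S := mem_image_of_mem _ hxS
      have hle : ∀ y ∈ (fun x ↦ Kerr.radius p.2 x) '' S, Kerr.radius p.2 x ≤ y := by
        rintro _ ⟨y, hyS, rfl⟩
        exact hxmin hyS
      have : sInf ((fun x ↦ Kerr.radius p.2 x) '' S) = Kerr.radius p.2 x :=
        le_antisymm (csInf_le ⟨Kerr.radius p.2 x, hle⟩ hmem) (le_csInf ⟨_, hmem⟩ hle)
      rw [this]
      exact h x hxS
    · intro h x hxS
      have hbdd : BddBelow ((fun x ↦ Kerr.radius p.2 x) '' S) :=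
        ⟨0, by rintro _ ⟨y, -, rfl⟩; exact Kerr.radius_nonneg _ _⟩
      exact h.trans_le (csInf_le hbdd (mem_image_of_mem _ hxS))
  have hs_nhds : s ∈ 𝓝 (M₀, a₀) := by
    rw [hs_eq]
    exact (isOpen_Ioi.preimage hinf).mem_nhds (by rw [← hs_eq]; exact hq)
  -- transverse uniform continuity along the compact fibre
  have hcont : @ContinuousOn ((ℝ × ℝ) × E4) (E4 →L[ℝ] E4 →L[ℝ] ℝ) _ UniformSpace.toTopologicalSpace
      (Function.uncurry fun (p : ℝ × ℝ) (x : E4) ↦ Kerr.bilin p.1 p.2 x) (s ×ˢ S) := by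
    exact continuousOn_kerr_bilin_param.mono fun q hq' ↦ hq'.1 q.2 hq'.2
  obtain ⟨v, hv, hvu⟩ := hS.mem_uniformity_of_prod
    (f := fun (p : ℝ × ℝ) (x : E4) ↦ Kerr.bilin p.1 p.2 x) (s := s)
    (u := {y : (E4 →L[ℝ] E4 →L[ℝ] ℝ) × (E4 →L[ℝ] E4 →L[ℝ] ℝ) | dist y.1 y.2 < ε}) hcont hq
    (by exact Metric.dist_mem_uniformity (α := E4 →L[ℝ] E4 →L[ℝ] ℝ) hε)
  rw [nhdsWithin_eq_nhds.mpr hs_nhds] at hv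
  filter_upwards [hv] with p hp x hx
  exact hvu p hp x hx


/-! ### §C Order reduction by interpolation -/

/-- **Interpolation reduces the order.** Abstract shape of "`C²`-recurrence + a-priori `Cᵐ`
BOUNDEDNESS at the same times ⇒ `Cᵏ`-recurrence": if three size functionals `n₂ ≤ nₖ ≤ nₘ` of the
deviation at time `τ` obey a multiplicative interpolation inequality
`nₖ τ ≤ C · (n₂ τ)^θ · (nₘ τ)^(1-θ)` with `0 < θ` (Landau–Kolmogorov / Gagliardo–Nirenberg on
the slab), then smallness of `n₂` infinitely often together with a bound `nₘ ≤ B` at the SAME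
times gives smallness of `nₖ` infinitely often. (For the train witness of the card the bound `B`
fails — that is the point: the a-priori higher bound is where far-field quarantine enters.) -/
theorem interp_reduces_order {n₂ nₖ nₘ : ℝ → ℝ} {C θ B : ℝ} (hC : 0 ≤ C) (hθ : 0 < θ)
    (hθ1 : θ ≤ 1) (hB : 0 ≤ B) (hn₂ : ∀ τ, 0 ≤ n₂ τ) (hnₘ : ∀ τ, 0 ≤ nₘ τ)
    (hinterp : ∀ τ, nₖ τ ≤ C * (n₂ τ) ^ θ * (nₘ τ) ^ (1 - θ))
    (hrec : ∀ ε > 0, ∃ᶠ τ in atTop, n₂ τ ≤ ε ∧ nₘ τ ≤ B) :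
    ∀ ε > 0, ∃ᶠ τ in atTop, nₖ τ ≤ ε := by
  intro ε hε
  -- choose `η` with `C * η^θ * B^(1-θ) ≤ ε`
  set A : ℝ := C * B ^ (1 - θ) + 1 with hA
  have hApos : 0 < A := by
    have : 0 ≤ C * B ^ (1 - θ) := mul_nonneg hC (Real.rpow_nonneg hB _)
    linarith
  set η : ℝ := (ε / A) ^ (1 / θ) with hη
  have hεA : 0 < ε / A := div_pos hε hApos
  have hηpos : 0 < η := Real.rpow_pos_of_pos hεA _
  have hηθ : η ^ θ = ε / A := by
    rw [hη, ← Real.rpow_mul hεA.le, one_div_mul_cancel hθ.ne', Real.rpow_one]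
  refine (hrec η hηpos).mono fun τ ⟨h2, hm⟩ ↦ ?_
  have hpow2 : (n₂ τ) ^ θ ≤ η ^ θ := Real.rpow_le_rpow (hn₂ τ) h2 hθ.le
  have hpowm : (nₘ τ) ^ (1 - θ) ≤ B ^ (1 - θ) :=
    Real.rpow_le_rpow (hnₘ τ) hm (by linarith)
  calc nₖ τ ≤ C * (n₂ τ) ^ θ * (nₘ τ) ^ (1 - θ) := hinterp τ
    _ ≤ C * η ^ θ * B ^ (1 - θ) := by
        apply mul_le_mul (mul_le_mul_of_nonneg_left hpow2 hC) hpowm (Real.rpow_nonneg (hnₘ τ) _)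
        exact mul_nonneg hC (Real.rpow_nonneg hηpos.le _)
    _ = (ε / A) * (C * B ^ (1 - θ)) := by rw [hηθ]; ring
    _ ≤ (ε / A) * A := by
        apply mul_le_mul_of_nonneg_left _ hεA.le
        rw [hA]; linarith
    _ = ε := div_mul_cancel₀ ε hApos.ne'

end Summit.FinalStateConjecture.FinalStateConjecture.Cruxes.OmegaLimitMultiKerr.SketchIdeator2
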